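import Summits.ResolutionOfSingularities.ResolutionOfSingularities.Theorems.PurelyInseparableDim4PointTreeWitness
import Summits.ResolutionOfSingularities.ResolutionOfSingularities.Theorems.PurelyInseparableDim4TrapBaseChange
import Summits.ResolutionOfSingularities.ResolutionOfSingularities.Theorems.PurelyInseparableDim4IsolationConverse
import Summits.ResolutionOfSingularities.ResolutionOfSingularities.Theorems.PurelyInseparableDim4UniformNoReply
import HarnessLib

/-!
# Purely inseparable four-folds: RATIONALITY of the point-centre walk — with witnesses split over a subfield `L`, the
# `K̄`-walk of `z^p + F` is `L`-rational, so a certificate over `L` (e.g. a finite field) settles the `K̄`-theorem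
# (brick TY-3k part 11 «RATIONAL», cell `res-dim4-pi`)

[OURS · counted 0] (D-0157 DOOR 2; makes the point-tree theorem `exists_isMarkedResolution_of_witnesses` consumable by
certificates computed over a SUBFIELD `L ⊆ K̄` — the currency of the cell's engines; host item
stmt-ResolutionOfSingularities-16155, helper). Resolution of singularities in dimension ≥ 4 / characteristic `p` is NOT
proved here or anywhere in this programme.

Let `f : L → K` be a homomorphism of fields, `F ∈ L[x₁..x₄]`, and read `z^p + F` over `K`. If at a state `s` (over `L`)
the univariate witnesses `g_{j,i}(x_i) ∈ J_p⁺(F′_j) + (x_j)` have ALL THEIR `K`-ROOTS IN `L` («split»), then every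
`K`-edge out of the base-changed state `s ⊗ K` is the base change of an `L`-edge out of `s` (the new point `b ∈ K⁴`
has coordinates among the roots, hence is `L`-rational; `CentreBlowup.step` and `IsEquimultiplePoint` commute with `f`,
tree `BaseChange.step_map` / `isEquimultiplePoint_map_ringHom_iff`). Consequently termination (`Acc`) and the
hereditary witnesses transfer from the `L`-tree to the `K`-tree, and so do the root parameters.

* `map_aeval_X_polynomial`, `translate_map_ringHom`, `aeval_X_map_mem_sup` — base change of witnesses;
* **`exists_edge_preimage_of_split`** — `K`-edges out of `s ⊗ K` come from `L`-edges out of `s`;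
* **`acc_map_of_acc_of_split`** — `Acc` over `L` (+ hereditary split witnesses) ⇒ `Acc` over `K`;
* `reflTransGen_preimage_of_split` — `K`-reachable states are base changes of `L`-reachable states;
* `exists_root_preimage_of_split` — root parameters over `K` are `L`-rational;
* **`exists_isMarkedResolution_of_rational_certificate`** — `K = K̄` of characteristic `p`, `f : L → K`; `F ≠ 0` clean
  over `L`; split root witnesses; and below every `L`-rational root state: `Acc` of the `L`-walk and, at every
  `L`-reachable state, non-zero split chart witnesses ⇒ `∃ X′ π M′, IsMarkedResolution ⟨hypSheaf p (F ⊗ K), [], p⟩ π M′`.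

AI-produced formalisation, weaker than expert review. bears_on: LADDER-RESOLUTION:D157-DOOR2 (res-dim4-pi · TY-3k).
-/

set_option linter.dupNamespace false -- D-0017: single-problem summit path `Summit.<S>.<S>.…` by design

noncomputable section

open MvPolynomial Finset CategoryTheory AlgebraicGeometry Opposite TopologicalSpace

namespace Summit.ResolutionOfSingularities.ResolutionOfSingularities.Theorems.PIDim4

open Literature.AlgebraicGeometry.Resolution
open Literature.AlgebraicGeometry.Resolution.Hauser2010
open Literature.AlgebraicGeometry.Resolution.AffinePointBlowup (P A γ coord Wtop ξ)

namespace Equimultiple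

section Rational

variable {L K : Type} [Field L] [Field K] [DecidableEq L] [DecidableEq K] (f : L →+* K) {p : ℕ}
  [hp : Fact p.Prime]

omit [DecidableEq L] [DecidableEq K] hp in
/-- Base change of a univariate witness: `(g(x_i)) ⊗ K = (g ⊗ K)(x_i)`. [folklore] -/
theorem map_aeval_X_polynomial (i : Fin 4) (g : Polynomial L) :
    MvPolynomial.map f (Polynomial.aeval (X i : MvPolynomial (Fin 4) L) g) =
      Polynomial.aeval (X i : MvPolynomial (Fin 4) K) (g.map f) := by
  rw [Polynomial.aeval_def, Polynomial.aeval_def, Polynomial.eval₂_map, Polynomial.hom_eval₂, MvPolynomial.map_X]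
  congr 1
  ext r
  simp only [RingHom.comp_apply, MvPolynomial.algebraMap_eq, MvPolynomial.map_C]

omit [DecidableEq L] [DecidableEq K] hp in
/-- Translation commutes with the coefficient map at a rational point: `(G ⊗ K)(x + f b) = (G(x + b)) ⊗ K`.
[folklore] -/
theorem translate_map_ringHom (b : Fin 4 → L) (G : MvPolynomial (Fin 4) L) :
    PointBlowup.translate (f ∘ b) (MvPolynomial.map f G) = MvPolynomial.map f (PointBlowup.translate b G) := by
  have hg : (fun i => MvPolynomial.map f (X i + C (b i) : MvPolynomial (Fin 4) L)) =
      fun i => (X i + C ((f ∘ b) i) : MvPolynomial (Fin 4) K) := by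
    funext i
    rw [map_add, MvPolynomial.map_X, MvPolynomial.map_C, Function.comp_apply]
  unfold PointBlowup.translate
  rw [MvPolynomial.aeval_eq_bind₁, MvPolynomial.aeval_eq_bind₁, MvPolynomial.map_bind₁, hg]

omit [DecidableEq L] [DecidableEq K] hp in
/-- **Witnesses go up**: `g(x_i) ∈ J_p⁺(G) + (x_j)` over `L` gives `(g ⊗ K)(x_i) ∈ J_p⁺(G ⊗ K) + (x_j)` over `K`
(`J_p⁺` commutes with base change, tree `IsolationConverse.singLocusIdeal_map`). [folklore] -/
theorem aeval_X_map_mem_sup {G : MvPolynomial (Fin 4) L} {i j : Fin 4} {g : Polynomial L}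
    (hg : Polynomial.aeval (X i : MvPolynomial (Fin 4) L) g ∈
      singLocusIdeal p G ⊔ Ideal.span {(X j : MvPolynomial (Fin 4) L)}) :
    Polynomial.aeval (X i : MvPolynomial (Fin 4) K) (g.map f) ∈
      singLocusIdeal p (MvPolynomial.map f G) ⊔ Ideal.span {(X j : MvPolynomial (Fin 4) K)} := by
  rw [← map_aeval_X_polynomial, IsolationConverse.singLocusIdeal_map, ← MvPolynomial.map_X f j,
    ← Set.image_singleton, ← Ideal.map_span, ← Ideal.map_sup]
  exact Ideal.mem_map_of_mem _ hg

omit [DecidableEq L] [DecidableEq K] hp in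
/-- Root witnesses go up: `g(x_i) ∈ J_p⁺(F)` over `L` gives `(g ⊗ K)(x_i) ∈ J_p⁺(F ⊗ K)`. [folklore] -/
theorem aeval_X_map_mem {G : MvPolynomial (Fin 4) L} {i : Fin 4} {g : Polynomial L}
    (hg : Polynomial.aeval (X i : MvPolynomial (Fin 4) L) g ∈ singLocusIdeal p G) :
    Polynomial.aeval (X i : MvPolynomial (Fin 4) K) (g.map f) ∈ singLocusIdeal p (MvPolynomial.map f G) := by
  rw [← map_aeval_X_polynomial, IsolationConverse.singLocusIdeal_map]
  exact Ideal.mem_map_of_mem _ hg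

omit [DecidableEq L] [DecidableEq K] hp in
/-- A point of `K⁴` all of whose coordinates are in the image of `f` is `f ∘ b` for some `b ∈ L⁴`. [folklore] -/
theorem exists_comp_eq_of_forall_mem_range {bK : Fin 4 → K} (h : ∀ i, bK i ∈ Set.range f) :
    ∃ b : Fin 4 → L, f ∘ b = bK := by
  choose b hb using h
  exact ⟨b, funext hb⟩

omit hp in
/-- **`K`-EDGES OUT OF A BASE-CHANGED STATE COME FROM `L`-EDGES** when the chart witnesses at `s` are SPLIT: for
every chart `j` and `i ≠ j` a univariate `g_{j,i}(x_i) ∈ J_p⁺(F′_j) + (x_j)` over `L` all of whose `K`-roots lie in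
`f(L)`. Then every `K`-edge successor of `s ⊗ K` is `s′ ⊗ K` for an `L`-edge `s → s′`.
[cite: CossartJannsenSaito2020, proof of Thm. 3.10 (p. 50)] [cite: Hauser2010, §F] -/
theorem exists_edge_preimage_of_split (s : State L) (g : Fin 4 → Fin 4 → Polynomial L)
    (hg : ∀ j i, i ≠ j → Polynomial.aeval (X i : MvPolynomial (Fin 4) L) (g j i) ∈
      singLocusIdeal p (CentreBlowup.chartTransform p Finset.univ j s.F) ⊔ Ideal.span {(X j : MvPolynomial (Fin 4) L)})
    (hsplit : ∀ j i, i ≠ j → ∀ x : K, ((g j i).map f).eval x = 0 → x ∈ Set.range f) {s' : State K}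
    (h : Edge p Finset.univ (⟨MvPolynomial.map f s.F, s.r, s.exc⟩ : State K) s') :
    ∃ t : State L, Edge p Finset.univ s t ∧ s' = ⟨MvPolynomial.map f t.F, t.r, t.exc⟩ := by
  obtain ⟨j, bK, -, hbj, heq, hne, hs'⟩ := h
  -- the new point is `L`-rational
  have hrange : ∀ i, bK i ∈ Set.range f := by
    intro i
    by_cases hij : i = j
    · exact ⟨0, by rw [hij, hbj, map_zero]⟩
    · have hJ : singLocusIdeal p (CentreBlowup.chartTransform p Finset.univ j (MvPolynomial.map f s.F)) ⊔
          Ideal.span {(X j : MvPolynomial (Fin 4) K)} ≤ MvPolynomial.vanishingIdeal K {bK} := by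
        refine sup_le ((singLocusIdeal_le_vanishingIdeal_iff p Finset.univ j bK
          (⟨MvPolynomial.map f s.F, s.r, s.exc⟩ : State K)).mpr heq) ?_
        rw [Ideal.span_le, Set.singleton_subset_iff, SetLike.mem_coe, MvPolynomial.mem_vanishingIdeal_singleton_iff,
          MvPolynomial.aeval_X]
        exact hbj
      have hgK := aeval_X_map_mem_sup f (hg j i hij)
      rw [← UniformNoReply.chartTransform_map] at hgK
      exact hsplit j i hij (bK i) (eval_eq_zero_of_aeval_X_mem hJ hgK)
  obtain ⟨b, rfl⟩ := exists_comp_eq_of_forall_mem_range f hrange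
  -- read everything over `L`
  have hbjL : b j = 0 := f.injective (by rw [map_zero]; exact hbj)
  have heqL : CentreBlowup.IsEquimultiplePoint p Finset.univ j b s :=
    (BaseChange.isEquimultiplePoint_map_ringHom_iff f p Finset.univ j b s).mp heq
  rw [BaseChange.step_map] at hne hs'
  have hneL : (CentreBlowup.step p Finset.univ j b s).F ≠ 0 := fun h0 => hne (by
    change MvPolynomial.map f (CentreBlowup.step p Finset.univ j b s).F = 0
    rw [h0, map_zero])
  exact ⟨CentreBlowup.step p Finset.univ j b s, ⟨j, b, Finset.mem_univ j, hbjL, heqL, hneL, rfl⟩, hs'⟩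

omit hp in
/-- **TERMINATION GOES UP.** If the `L`-walk below `s` is well-founded and every `L`-reachable state carries split chart
witnesses, then the `K`-walk below `s ⊗ K` is well-founded. [cite: CossartJannsenSaito2020, proof of Thm. 3.10 (p. 50)] -/
theorem acc_map_of_acc_of_split {s : State L} (hacc : Acc (fun s' s : State L => Edge p Finset.univ s s') s)
    (hw : ∀ t : State L, Relation.ReflTransGen (fun a c : State L => Edge p Finset.univ a c) s t →
      ∃ g : Fin 4 → Fin 4 → Polynomial L,
        (∀ j i, i ≠ j → Polynomial.aeval (X i : MvPolynomial (Fin 4) L) (g j i) ∈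
          singLocusIdeal p (CentreBlowup.chartTransform p Finset.univ j t.F) ⊔
            Ideal.span {(X j : MvPolynomial (Fin 4) L)}) ∧
        ∀ j i, i ≠ j → ∀ x : K, ((g j i).map f).eval x = 0 → x ∈ Set.range f) :
    Acc (fun s' s : State K => Edge p Finset.univ s s') (⟨MvPolynomial.map f s.F, s.r, s.exc⟩ : State K) := by
  induction hacc with
  | intro s _ ih =>
    refine Acc.intro _ fun s' hedge => ?_
    obtain ⟨g, hg, hsplit⟩ := hw s Relation.ReflTransGen.refl
    obtain ⟨t, ht, rfl⟩ := exists_edge_preimage_of_split f s g hg hsplit hedge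
    exact ih t ht fun t' ht' => hw t' (Relation.ReflTransGen.head ht ht')

omit hp in
/-- **`K`-REACHABLE STATES ARE BASE CHANGES OF `L`-REACHABLE STATES** (hereditary split witnesses).
[cite: CossartJannsenSaito2020, proof of Thm. 3.10 (p. 50)] -/
theorem reflTransGen_preimage_of_split {s : State L}
    (hw : ∀ t : State L, Relation.ReflTransGen (fun a c : State L => Edge p Finset.univ a c) s t →
      ∃ g : Fin 4 → Fin 4 → Polynomial L,
        (∀ j i, i ≠ j → Polynomial.aeval (X i : MvPolynomial (Fin 4) L) (g j i) ∈
          singLocusIdeal p (CentreBlowup.chartTransform p Finset.univ j t.F) ⊔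
            Ideal.span {(X j : MvPolynomial (Fin 4) L)}) ∧
        ∀ j i, i ≠ j → ∀ x : K, ((g j i).map f).eval x = 0 → x ∈ Set.range f)
    {s' : State K}
    (h : Relation.ReflTransGen (fun a c : State K => Edge p Finset.univ a c)
      (⟨MvPolynomial.map f s.F, s.r, s.exc⟩ : State K) s') :
    ∃ t : State L, Relation.ReflTransGen (fun a c : State L => Edge p Finset.univ a c) s t ∧
      s' = ⟨MvPolynomial.map f t.F, t.r, t.exc⟩ := by
  induction h with
  | refl => exact ⟨s, Relation.ReflTransGen.refl, rfl⟩
  | tail _ hedge ih =>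
    obtain ⟨t, ht, rfl⟩ := ih
    obtain ⟨g, hg, hsplit⟩ := hw t ht
    obtain ⟨t', ht', rfl⟩ := exists_edge_preimage_of_split f t g hg hsplit hedge
    exact ⟨t', ht.tail ht', rfl⟩

omit [DecidableEq L] [DecidableEq K] hp in
/-- **ROOT PARAMETERS ARE `L`-RATIONAL** when the root witnesses are split: a `b ∈ K⁴` killing every non-constant
monomial of degree `< p` of `(F ⊗ K)(x + b)` is `f ∘ b_L` with `b_L` a root parameter of `F` over `L`.
[cite: CossartPiltant2019, Prop. 2.55] -/
theorem exists_root_preimage_of_split (F : MvPolynomial (Fin 4) L) (g : Fin 4 → Polynomial L)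
    (hg : ∀ i, Polynomial.aeval (X i : MvPolynomial (Fin 4) L) (g i) ∈ singLocusIdeal p F)
    (hsplit : ∀ i, ∀ x : K, ((g i).map f).eval x = 0 → x ∈ Set.range f) {bK : Fin 4 → K}
    (H : ∀ d : Fin 4 →₀ ℕ, d ≠ 0 → d.degree < p → coeff d (PointBlowup.translate bK (MvPolynomial.map f F)) = 0) :
    ∃ b : Fin 4 → L, f ∘ b = bK ∧
      ∀ d : Fin 4 →₀ ℕ, d ≠ 0 → d.degree < p → coeff d (PointBlowup.translate b F) = 0 := by
  have hrange : ∀ i, bK i ∈ Set.range f := fun i =>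
    hsplit i (bK i) (eval_eq_zero_of_aeval_X_mem
      (singLocusIdeal_le_vanishingIdeal_of_roots (MvPolynomial.map f F) bK H) (aeval_X_map_mem f (hg i)))
  obtain ⟨b, rfl⟩ := exists_comp_eq_of_forall_mem_range f hrange
  refine ⟨b, rfl, fun d hd hdeg => f.injective ?_⟩
  rw [map_zero, ← MvPolynomial.coeff_map, ← translate_map_ringHom]
  exact H d hd hdeg

omit [DecidableEq L] [DecidableEq K] hp in
/-- Cleanness is invariant under injective base change. [cite: HauserPerlega2019PRIMS, §2 (cleaning)] -/
theorem isClean_map {F : MvPolynomial (Fin 4) L}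
    (hclean : Literature.Barriers.ResolutionOfSingularities.HauserPerlega.IsClean p F) :
    Literature.Barriers.ResolutionOfSingularities.HauserPerlega.IsClean p (MvPolynomial.map f F) := by
  intro d hd
  rw [MvPolynomial.support_map_of_injective F f.injective] at hd
  exact hclean d hd

/-- **TERMINATION ⇒ ORDER REDUCTION FROM A CERTIFICATE OVER A SUBFIELD.** `K = K̄` of characteristic `p`,
`f : L → K` a homomorphism of fields, `F ∈ L[x₁..x₄]` non-zero and clean. Suppose (roots) univariate witnesses
`g_i(x_i) ∈ J_p⁺(F)` over `L`, non-zero and SPLIT (all `K`-roots in `f(L)`); and for every `L`-rational root parameter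
`b`: (termination) the `L`-walk below `s_b = (deletePthPowers p (F(x + b)), 0, ∅)` is well-founded, and (branching) every
`L`-reachable state carries non-zero split chart witnesses. Then `(𝔸⁵_K, (z^p + F ⊗ K)·𝒪, [], p)` admits a marked
resolution — all hypotheses live over `L` (decidable when `L` is, e.g., finite). NOT `OrderReduction p`.
[cite: BierstoneGrigorievMilmanWlodarczyk2011, Def. 3.1.3] [cite: CossartJannsenSaito2020, proof of Thm. 3.10 (p. 50)]
[cite: Hironaka1964, Main Theorem I (the characteristic-zero statement whose analogue is asked)] -/
theorem exists_isMarkedResolution_of_rational_certificate [IsAlgClosed K] [CharP K p]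
    (F : MvPolynomial (Fin 4) L) (hF : F ≠ 0)
    (hclean : Literature.Barriers.ResolutionOfSingularities.HauserPerlega.IsClean p F)
    (g₀ : Fin 4 → Polynomial L) (hg₀0 : ∀ i, g₀ i ≠ 0)
    (hg₀ : ∀ i, Polynomial.aeval (X i : MvPolynomial (Fin 4) L) (g₀ i) ∈ singLocusIdeal p F)
    (hsplit₀ : ∀ i, ∀ x : K, ((g₀ i).map f).eval x = 0 → x ∈ Set.range f)
    (hwalk : ∀ b : Fin 4 → L, (∀ d : Fin 4 →₀ ℕ, d ≠ 0 → d.degree < p → coeff d (PointBlowup.translate b F) = 0) →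
      Acc (fun s' s : State L => Edge p Finset.univ s s')
          (⟨deletePthPowers p (PointBlowup.translate b F), 0, ∅⟩ : State L) ∧
        ∀ t : State L, Relation.ReflTransGen (fun a c : State L => Edge p Finset.univ a c)
            (⟨deletePthPowers p (PointBlowup.translate b F), 0, ∅⟩ : State L) t →
          ∃ g : Fin 4 → Fin 4 → Polynomial L, (∀ j i, i ≠ j → g j i ≠ 0) ∧
            (∀ j i, i ≠ j → Polynomial.aeval (X i : MvPolynomial (Fin 4) L) (g j i) ∈
              singLocusIdeal p (CentreBlowup.chartTransform p Finset.univ j t.F) ⊔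
                Ideal.span {(X j : MvPolynomial (Fin 4) L)}) ∧
            ∀ j i, i ≠ j → ∀ x : K, ((g j i).map f).eval x = 0 → x ∈ Set.range f) :
    ∃ (X' : Scheme.{0}) (π : X' ⟶ P 4 K) (M' : MarkedIdeal X'),
      IsMarkedResolution (⟨hypSheaf p (MvPolynomial.map f F), [], p⟩ : MarkedIdeal (P 4 K)) π M' := by
  refine exists_isMarkedResolution_of_witnesses (MvPolynomial.map f F)
    (fun h0 => hF (MvPolynomial.map_injective f f.injective (by rw [h0, map_zero]))) (isClean_map f hclean)
    (fun i => (g₀ i).map f) (fun i => (Polynomial.map_eq_zero_iff f.injective).not.mpr (hg₀0 i))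
    (fun i => aeval_X_map_mem f (hg₀ i)) fun bK HK => ?_
  -- the root is `L`-rational
  obtain ⟨b, rfl, H⟩ := exists_root_preimage_of_split f F g₀ hg₀ hsplit₀ HK
  obtain ⟨hacc, hw⟩ := hwalk b H
  have hstate : (⟨deletePthPowers p (PointBlowup.translate (f ∘ b) (MvPolynomial.map f F)), 0, ∅⟩ : State K) =
      ⟨MvPolynomial.map f (⟨deletePthPowers p (PointBlowup.translate b F), 0, ∅⟩ : State L).F,
        (⟨deletePthPowers p (PointBlowup.translate b F), 0, ∅⟩ : State L).r,
        (⟨deletePthPowers p (PointBlowup.translate b F), 0, ∅⟩ : State L).exc⟩ := by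
    rw [translate_map_ringHom,
      ← Summit.ResolutionOfSingularities.ResolutionOfSingularities.Theorems.CampaignW46.MohWindowShadePS.deletePthPowers_map]
  have hw' : ∀ t : State L, Relation.ReflTransGen (fun a c : State L => Edge p Finset.univ a c)
      (⟨deletePthPowers p (PointBlowup.translate b F), 0, ∅⟩ : State L) t →
      ∃ g : Fin 4 → Fin 4 → Polynomial L,
        (∀ j i, i ≠ j → Polynomial.aeval (X i : MvPolynomial (Fin 4) L) (g j i) ∈
          singLocusIdeal p (CentreBlowup.chartTransform p Finset.univ j t.F) ⊔
            Ideal.span {(X j : MvPolynomial (Fin 4) L)}) ∧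
        ∀ j i, i ≠ j → ∀ x : K, ((g j i).map f).eval x = 0 → x ∈ Set.range f := fun t ht => by
    obtain ⟨g, -, hg, hsplit⟩ := hw t ht
    exact ⟨g, hg, hsplit⟩
  rw [hstate]
  refine ⟨acc_map_of_acc_of_split f hacc hw', fun s' hs' => ?_⟩
  obtain ⟨t, ht, rfl⟩ := reflTransGen_preimage_of_split f hw' hs'
  obtain ⟨g, hg0, hg, -⟩ := hw t ht
  refine ⟨fun j i => (g j i).map f, fun j i hij => (Polynomial.map_eq_zero_iff f.injective).not.mpr (hg0 j i hij),
    fun j i hij => ?_⟩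
  have h := aeval_X_map_mem_sup f (hg j i hij)
  rw [← UniformNoReply.chartTransform_map] at h
  exact h

end Rational

end Equimultiple

end Summit.ResolutionOfSingularities.ResolutionOfSingularities.Theorems.PIDim4

end
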